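import Literature.NumberTheory.Sieve.BombieriFriedlanderIwaniecBlocks
import Literature.NumberTheory.Sieve.BombieriFriedlanderIwaniecRanges
import Literature.NumberTheory.Sieve.BombieriFriedlanderIwaniecPieces
import HarnessLib

/-!
# Bombieri–Friedlander–Iwaniec 1986, §17: tools for dispatching the interior pieces

Topic `Literature/NumberTheory/Sieve`, companion to
`Literature.NumberTheory.Sieve.BombieriFriedlanderIwaniecBlocks` (the block decomposition of the
moduli carrying a well-factorable weight) and `…Ranges` (the exponent ranges of Theorems 0 (b), 1,
2, 5* in the proof of Theorem 10).  Everything here is PROVED; it is the bookkeeping shared by the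
cases of §17 (files `…CaseA`, `…CaseB`):

* `Literature.NumberTheory.Sieve.BFI.thm5_ranges'` — the range of Theorem 5* with the level of `R`
  raised to `X^{1/7+ε/50}` (slack `τ > 3/7 − ε` for the large variable);
* `Literature.NumberTheory.Sieve.BFI.wellFactorable_blocks` — the split `λ = λ₁ ⋆ λ₂` at
  `D = D₁ D₂` with the dyadic depth `K₁`, `D₁ < 2^{K₁} ≤ 2D₁`;
* `Literature.NumberTheory.Sieve.BFI.abs_dispD_le_of_sq_bound` — the `ℓ²` bookkeeping turning the
  `𝒟²`-form of Theorems 1, 2 into `|𝒟| ≤ 2 √C₁ C_l X' (2 log X')^{2E'} (log X')^{−A'/2}`;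
* `Literature.NumberTheory.Sieve.BFI.a5_of_dense` — hypothesis (A₅) of Theorem 2 for dense pieces;
* growth lemmas: `exp_sqrt_log_le` (`z = exp(√log x)` is admissible in Theorem 5*),
  `exists_log_rpow_lt_exp_sqrt` ((A₄) for `z`-rough pieces), `rpow_scale_le` (`X' ≤ 2^{15} x`),
  `exists_level_le_thm0b`, `exists_polylog_le_rpow`, `natCast_le_four_mul_log`, and the `√‖·‖²`
  algebra `sqrt_l2Sq_mul_le`, `sqrt_l2Sq_le`, `thm0b_bound_algebra`.

## References

* E. Bombieri, J. B. Friedlander, H. Iwaniec, *Primes in arithmetic progressions to large moduli*,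
  Acta Math. 156 (1986), 203–251, §17 p. 249. [BombieriFriedlanderIwaniecActa1986]
-/

open Finset Real
open scoped ArithmeticFunction.sigma

namespace Literature.NumberTheory.Sieve

namespace BFI

/-! ### The range of Theorem 5* with slack -/

/-- **The range of Theorem 5* in the proof of Theorem 10, with slack** (BFI p. 249: "Theorem 5* is
applicable with `M = N₁ = x^{ν₁} ≥ x^{3/7}` and `Q, R ≤ x^{2/7−2ε}`"): with the bookkeeping
`D₂ = X^{1/7 + ε/50}`, `D₁ ≤ X^{3/7 − ε − ε/50}` (so that the product level is `X^{4/7−ε}`), for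
`0 < ε ≤ 1/1000`, `3/7 − ε < τ ≤ 1 − ε/100`, `X ≥ 2`, `M = X^τ`, `MN = X` and a block
`1/2 ≤ Q ≤ X^{3/7−ε−ε/50}`, `1/2 ≤ R ≤ X^{1/7+ε/50}`: the numerical hypotheses (A₁), `QR < X` and
(12.5) of `Literature.NumberTheory.Sieve.BombieriFriedlanderIwaniecTheorem5StarInterval` (range
parameter `ε/100`) hold.  Compared with `thm5_ranges` the level of `R` is raised by `X^{ε/50}`,
which buys the slack `τ > 3/7 − ε` (instead of `τ > 3/7 − ε + ε/100`).
[cite: BombieriFriedlanderIwaniecActa1986, §17 p. 249] -/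
theorem thm5_ranges' {ε τ X M N Q R : ℝ} (hε : 0 < ε) (hε' : ε ≤ 1 / 1000)
    (hτ1 : 3 / 7 - ε < τ) (hτ2 : τ ≤ 1 - ε / 100)
    (hX : 2 ≤ X) (hM : M = X ^ τ) (hMN : M * N = X)
    (hQ0 : 1 / 2 ≤ Q) (hR0 : 1 / 2 ≤ R) (hQ : Q ≤ X ^ (3 / 7 - ε - ε / 50))
    (hR : R ≤ X ^ (1 / 7 + ε / 50)) :
    X ^ (ε / 100) ≤ N ∧ N ≤ X ^ (1 - ε / 100) ∧ Q * R < X ∧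
    X ^ (ε / 100) * thm5Threshold X Q R < M := by
  have hX0 : 0 < X := by linarith
  have hX1 : 1 < X := by linarith
  have hQpos : 0 < Q := by linarith
  have hRpos : 0 < R := by linarith
  set ε₁ : ℝ := ε / 100 with hε₁
  set θ : ℝ := 3 / 7 - ε - ε / 50 with hθ
  set ρ : ℝ := 1 / 7 + ε / 50 with hρ
  have lt_of_exp : ∀ {u v : ℝ}, u < v → X ^ u < X ^ v := fun h => Real.rpow_lt_rpow_of_exponent_lt hX1 h
  have le_of_exp : ∀ {u v : ℝ}, u ≤ v → X ^ u ≤ X ^ v := fun h => Real.rpow_le_rpow_of_exponent_le hX1.le h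
  have hMpos : 0 < M := by rw [hM]; exact Real.rpow_pos_of_pos hX0 τ
  have hN : N = X ^ (1 - τ) := by
    have h : N = X / M := by field_simp; linarith
    rw [h, hM, Real.rpow_sub hX0, Real.rpow_one]
  have hR4 : R ^ 4 ≤ X ^ (ρ * 4) := by
    have h := pow_le_pow_left₀ hRpos.le hR 4
    rwa [rpow_pow_natCast hX0.le] at h
  have hQ3 : Q ^ 3 ≤ X ^ (θ * 3) := by
    have h := pow_le_pow_left₀ hQpos.le hQ 3
    rwa [rpow_pow_natCast hX0.le] at h
  have hQhalf : Q ^ (1 / 2 : ℝ) ≤ X ^ (θ * (1 / 2 : ℝ)) := by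
    rw [Real.rpow_mul hX0.le]
    exact Real.rpow_le_rpow hQpos.le hQ (by norm_num)
  refine ⟨?_, ?_, ?_, ?_⟩
  · rw [hN]; exact le_of_exp (by linarith)
  · rw [hN]; exact le_of_exp (by linarith)
  · have hlt : X ^ (θ + ρ) < X := by
      have h := lt_of_exp (show θ + ρ < 1 by simp only [hθ, hρ]; linarith)
      rwa [Real.rpow_one] at h
    calc Q * R ≤ X ^ θ * X ^ ρ := mul_le_mul hQ hR hRpos.le (Real.rpow_nonneg hX0.le _)
      _ = X ^ (θ + ρ) := rpow_mul_rpow hX0 _ _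
      _ < X := hlt
  · have hthr : thm5Threshold X Q R < X ^ (τ - ε₁) := by
      unfold thm5Threshold
      refine max_lt (max_lt ?_ ?_) (max_lt ?_ ?_)
      · exact lt_of_le_of_lt hQ (lt_of_exp (by simp only [hθ]; linarith))
      · calc X⁻¹ * Q * R ^ 4 ≤ X⁻¹ * X ^ θ * X ^ (ρ * 4) := by
              refine mul_le_mul (mul_le_mul_of_nonneg_left hQ (by positivity)) hR4 (by positivity) ?_
              positivity
          _ = X ^ ((-1 : ℝ) + θ + ρ * 4) := by
              rw [Real.rpow_add hX0, Real.rpow_add hX0, Real.rpow_neg hX0.le, Real.rpow_one]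
          _ < X ^ (τ - ε₁) := lt_of_exp (by simp only [hθ, hρ]; linarith)
      · calc Q ^ (1 / 2 : ℝ) * R ≤ X ^ (θ * (1 / 2 : ℝ)) * X ^ ρ :=
              mul_le_mul hQhalf hR hRpos.le (Real.rpow_nonneg hX0.le _)
          _ = X ^ (θ * (1 / 2 : ℝ) + ρ) := rpow_mul_rpow hX0 _ _
          _ < X ^ (τ - ε₁) := lt_of_exp (by simp only [hθ, hρ]; linarith)
      · calc X ^ (-2 : ℝ) * Q ^ 3 * R ^ 4 ≤ X ^ (-2 : ℝ) * X ^ (θ * 3) * X ^ (ρ * 4) := by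
              refine mul_le_mul (mul_le_mul_of_nonneg_left hQ3 (Real.rpow_nonneg hX0.le _)) hR4
                (by positivity) ?_
              exact mul_nonneg (Real.rpow_nonneg hX0.le _) (Real.rpow_nonneg hX0.le _)
          _ = X ^ ((-2 : ℝ) + θ * 3 + ρ * 4) := by
              rw [Real.rpow_add hX0, Real.rpow_add hX0]
          _ < X ^ (τ - ε₁) := lt_of_exp (by simp only [hθ, hρ]; linarith)
    calc X ^ ε₁ * thm5Threshold X Q R < X ^ ε₁ * X ^ (τ - ε₁) :=
          mul_lt_mul_of_pos_left hthr (Real.rpow_pos_of_pos hX0 _)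
      _ = M := by rw [rpow_mul_rpow hX0, hM]; congr 1; ring

/-! ### Growth lemmas -/

/-- `log L ≤ √L` for `L > 0` (from `log u ≤ u − 1` at `u = L^{1/4}` and `t(4 − t) ≤ 4`). [folklore] -/
theorem log_le_sqrt {L : ℝ} (hL : 0 < L) : Real.log L ≤ Real.sqrt L := by
  set t : ℝ := Real.sqrt (Real.sqrt L) with ht
  have ht0 : 0 ≤ t := Real.sqrt_nonneg _
  have htt : t * t = Real.sqrt L := Real.mul_self_sqrt (Real.sqrt_nonneg _)
  have hL4 : L = t ^ 4 := by
    have h1 : Real.sqrt L * Real.sqrt L = L := Real.mul_self_sqrt hL.le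
    nlinarith [htt]
  have htpos : 0 < t := by
    rcases ht0.lt_or_eq with h | h
    · exact h
    · exfalso; rw [← h] at hL4; simp at hL4; linarith
  have h1 : Real.log L = 4 * Real.log t := by
    rw [hL4, Real.log_pow]; norm_num
  have h2 : Real.log t ≤ t - 1 := Real.log_le_sub_one_of_pos htpos
  rw [h1, ← htt]
  nlinarith [sq_nonneg (t - 2)]

/-- `t ↦ t / log t` is non-decreasing on `[e, ∞)`: for `e ≤ L ≤ L'`, `L/log L ≤ L'/log L'`
(`log L' ≤ log L + (L'/L − 1)`). [folklore] -/
theorem div_log_mono {L L' : ℝ} (hL : Real.exp 1 ≤ L) (hLL' : L ≤ L') :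
    L / Real.log L ≤ L' / Real.log L' := by
  have hL0 : 0 < L := (Real.exp_pos 1).trans_le hL
  have hL'0 : 0 < L' := hL0.trans_le hLL'
  have hlogL : 1 ≤ Real.log L := by rwa [Real.le_log_iff_exp_le hL0]
  have hlogL' : 1 ≤ Real.log L' := hlogL.trans (Real.log_le_log hL0 hLL')
  have hq : Real.log L' ≤ Real.log L + (L' / L - 1) := by
    have h1 : Real.log L' = Real.log L + Real.log (L' / L) := by
      rw [← Real.log_mul hL0.ne' (by positivity)]; congr 1; field_simp
    rw [h1]
    have : Real.log (L' / L) ≤ L' / L - 1 := Real.log_le_sub_one_of_pos (by positivity)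
    linarith
  rw [div_le_div_iff₀ (by linarith) (by linarith)]
  have h3 : L * Real.log L' ≤ L * Real.log L + (L' - L) := by
    have := mul_le_mul_of_nonneg_left hq hL0.le
    have h4 : L * (Real.log L + (L' / L - 1)) = L * Real.log L + (L' - L) := by field_simp
    linarith
  nlinarith

/-- The sifting level `z = exp(√log x)` is admissible in Theorem 5* at every `X' ≥ x ≥ e^e`:
`exp(√log x) ≤ exp(log X' / log log X')`. [folklore] -/
theorem exp_sqrt_log_le {x X' : ℝ} (hx : Real.exp (Real.exp 1) ≤ x) (hxX : x ≤ X') :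
    Real.exp (Real.sqrt (Real.log x)) ≤ Real.exp (Real.log X' / Real.log (Real.log X')) := by
  have hx0 : 0 < x := (Real.exp_pos _).trans_le hx
  have hL : Real.exp 1 ≤ Real.log x := by rwa [Real.le_log_iff_exp_le hx0]
  have hL0 : 0 < Real.log x := (Real.exp_pos 1).trans_le hL
  have hLL' : Real.log x ≤ Real.log X' := Real.log_le_log hx0 hxX
  rw [Real.exp_le_exp]
  have hlog1 : 1 ≤ Real.log (Real.log x) := by rwa [Real.le_log_iff_exp_le hL0]
  calc Real.sqrt (Real.log x) ≤ Real.log x / Real.log (Real.log x) := by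
        rw [le_div_iff₀ (by linarith)]
        calc Real.sqrt (Real.log x) * Real.log (Real.log x)
            ≤ Real.sqrt (Real.log x) * Real.sqrt (Real.log x) :=
              mul_le_mul_of_nonneg_left (log_le_sqrt hL0) (Real.sqrt_nonneg _)
          _ = Real.log x := Real.mul_self_sqrt hL0.le
    _ ≤ Real.log X' / Real.log (Real.log X') := div_log_mono hL hLL'

/-- The dyadic depth is logarithmic: if `2^K ≤ 2T` and `1 ≤ T ≤ Y`, `2 ≤ Y` then `K ≤ 4 log Y`. [folklore] -/
theorem natCast_le_four_mul_log {K : ℕ} {T Y : ℝ} (hK : (2 : ℝ) ^ K ≤ 2 * T) (hT : 1 ≤ T) (hY : 2 ≤ Y)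
    (hTY : T ≤ Y) : (K : ℝ) ≤ 4 * Real.log Y := by
  have h2 : (0.6931471803 : ℝ) < Real.log 2 := Real.log_two_gt_d9
  have hlogK : (K : ℝ) * Real.log 2 ≤ Real.log 2 + Real.log T := by
    have h := Real.log_le_log (by positivity) hK
    rwa [Real.log_pow, Real.log_mul (by norm_num) (by linarith)] at h
  have hlogT : Real.log T ≤ Real.log Y := Real.log_le_log (by linarith) hTY
  have hlog2Y : Real.log 2 ≤ Real.log Y := Real.log_le_log (by norm_num) hY
  have hK2 : (K : ℝ) * Real.log 2 ≤ 2 * Real.log Y := by linarith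
  have hK0 : (0 : ℝ) ≤ K := Nat.cast_nonneg K
  nlinarith

/-- **Polylogarithms are eventually below `exp(√log x)`**, uniformly for `X' ∈ [x, 2^{15} x]`:
for every `B` there is `x₀` with `(log X')^B < exp(√log x)` for `x ≥ x₀`, `x ≤ X' ≤ 2^{15} x`.
(Used to check hypothesis (A₄), `β_n = 0` if `n` has a prime factor `≤ ℒ^{B₀}`, for `z`-rough
`β` with `z = exp(√log x)`; BFI (15.4) p. 244: "any number `z` with `N₀ < z < z₀` would be equally
good".) [cite: BombieriFriedlanderIwaniecActa1986, §15 (15.4) p. 244] -/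
theorem exists_log_rpow_lt_exp_sqrt (B : ℝ) :
    ∃ x₀ : ℝ, ∀ x X' : ℝ, x₀ ≤ x → x ≤ X' → X' ≤ 2 ^ 15 * x →
      Real.log X' ^ B < Real.exp (Real.sqrt (Real.log x)) := by
  obtain ⟨C, hC, h⟩ := exists_rpow_mul_exp_neg_sqrt_le (max B 0 + 1) one_pos
  refine ⟨max (2 ^ 15) (Real.exp (2 ^ max B 0 * C + 1)), fun x X' hx hxX hX'x => ?_⟩
  have hx15 : (2 : ℝ) ^ 15 ≤ x := le_trans (le_max_left _ _) hx
  have hxC : Real.exp (2 ^ max B 0 * C + 1) ≤ x := le_trans (le_max_right _ _) hx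
  have hx0 : 0 < x := by linarith
  set L := Real.log x with hL
  have hL1 : 2 ^ max B 0 * C + 1 ≤ L := by rwa [hL, Real.le_log_iff_exp_le hx0]
  have hLC : 2 ^ max B 0 * C < L := by linarith
  have hL1' : 1 ≤ L := by
    have : (0:ℝ) ≤ 2 ^ max B 0 * C := by positivity
    linarith
  have hL0 : 0 < L := by linarith
  have hLX : Real.log X' ≤ 2 * L := by
    have h1 : X' ≤ x ^ 2 := by nlinarith
    calc Real.log X' ≤ Real.log (x ^ 2) := Real.log_le_log (by linarith) h1
      _ = 2 * L := by rw [Real.log_pow, hL]; norm_num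
  have hLX1 : 1 ≤ Real.log X' := hL1'.trans (Real.log_le_log hx0 hxX)
  -- `(log X')^B ≤ (2L)^{B⁺} = 2^{B⁺} L^{B⁺}` and `L^{B⁺ + 1} ≤ C e^{√L}`
  have h1 : Real.log X' ^ B ≤ 2 ^ max B 0 * L ^ max B 0 := by
    calc Real.log X' ^ B ≤ Real.log X' ^ max B 0 := Real.rpow_le_rpow_of_exponent_le hLX1 (le_max_left _ _)
      _ ≤ (2 * L) ^ max B 0 := Real.rpow_le_rpow (by linarith) hLX (le_max_right _ _)
      _ = 2 ^ max B 0 * L ^ max B 0 := Real.mul_rpow (by norm_num) hL0.le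
  have h2 := h L hL1'
  rw [one_mul, Real.rpow_add hL0, Real.rpow_one] at h2
  -- `L^{B⁺} * L * e^{-√L} ≤ C` ⇒ `L^{B⁺} ≤ C e^{√L} / L`
  have h3 : L ^ max B 0 ≤ C * Real.exp (Real.sqrt L) / L := by
    rw [le_div_iff₀ hL0]
    have h4 : L ^ max B 0 * L = (L ^ max B 0 * L * Real.exp (-Real.sqrt L)) * Real.exp (Real.sqrt L) := by
      rw [mul_assoc (L ^ max B 0 * L), ← Real.exp_add, neg_add_cancel, Real.exp_zero, mul_one]
    rw [h4]
    exact mul_le_mul_of_nonneg_right h2 (Real.exp_pos _).le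
  calc Real.log X' ^ B ≤ 2 ^ max B 0 * L ^ max B 0 := h1
    _ ≤ 2 ^ max B 0 * (C * Real.exp (Real.sqrt L) / L) := mul_le_mul_of_nonneg_left h3 (by positivity)
    _ = (2 ^ max B 0 * C / L) * Real.exp (Real.sqrt L) := by ring
    _ < 1 * Real.exp (Real.sqrt L) := by
        refine mul_lt_mul_of_pos_right ?_ (Real.exp_pos _)
        rwa [div_lt_one hL0]
    _ = Real.exp (Real.sqrt L) := one_mul _

/-- Exponent bookkeeping between the two scales: for `x ≥ 2^{105}`, `x ≤ X' ≤ 2^{15} x` and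
`0 ≤ u ≤ 1`, `X'^u ≤ x^{u + 1/7}` (since `2^{15u} ≤ 2^{15} ≤ x^{1/7}`). [folklore] -/
theorem rpow_scale_le {x X' u : ℝ} (hx : (2 : ℝ) ^ 105 ≤ x) (hxX : x ≤ X') (hX'x : X' ≤ 2 ^ 15 * x)
    (hu0 : 0 ≤ u) (hu1 : u ≤ 1) : X' ^ u ≤ x ^ (u + 1 / 7) := by
  have hx0 : 0 < x := by linarith [pow_pos (two_pos : (0:ℝ) < 2) 105]
  have hx1 : 1 ≤ x := le_trans (one_le_pow₀ (by norm_num)) hx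
  have h7 : (2 : ℝ) ^ 15 ≤ x ^ (1 / 7 : ℝ) := by
    have h1 : ((2 : ℝ) ^ 15) ^ (7 : ℕ) ≤ (x ^ (1 / 7 : ℝ)) ^ (7 : ℕ) := by
      rw [← Real.rpow_natCast (x ^ (1 / 7 : ℝ)) 7, ← Real.rpow_mul hx0.le, ← pow_mul]
      norm_num
      norm_num at hx
      exact hx
    exact (pow_le_pow_iff_left₀ (by positivity) (Real.rpow_nonneg hx0.le _) (by norm_num)).1 h1
  calc X' ^ u ≤ (2 ^ 15 * x) ^ u := Real.rpow_le_rpow (by linarith) hX'x hu0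
    _ = (2 ^ 15) ^ u * x ^ u := Real.mul_rpow (by norm_num) hx0.le
    _ ≤ 2 ^ 15 * x ^ u := by
        refine mul_le_mul_of_nonneg_right ?_ (Real.rpow_nonneg hx0.le _)
        calc ((2 : ℝ) ^ 15) ^ u ≤ ((2 : ℝ) ^ 15) ^ (1 : ℝ) :=
              Real.rpow_le_rpow_of_exponent_le (by norm_num) hu1
          _ = 2 ^ 15 := Real.rpow_one _
    _ ≤ x ^ (1 / 7 : ℝ) * x ^ u := mul_le_mul_of_nonneg_right h7 (Real.rpow_nonneg hx0.le _)
    _ = x ^ (u + 1 / 7) := by rw [← Real.rpow_add hx0]; ring_nf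

/-- The level kept for Theorem 0 (b) is eventually admissible: for `ε > 0` and any `B₁` there is
`x₀` with `X'^{1/2−2ε} ≤ X'^{1/2} (log X')^{−B₁}` for `X' ≥ x₀`. [folklore] -/
theorem exists_level_le_thm0b (B₁ : ℝ) {ε : ℝ} (hε : 0 < ε) :
    ∃ x₀ : ℝ, ∀ X' : ℝ, x₀ ≤ X' → X' ^ (1 / 2 - 2 * ε) ≤ X' ^ (1 / 2 : ℝ) / Real.log X' ^ B₁ := by
  obtain ⟨C, hC, h⟩ := exists_log_rpow_le_rpow (le_max_right B₁ 0) hε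
  refine ⟨max (Real.exp 1) (C ^ (1 / ε)), fun X' hX' => ?_⟩
  have hXe : Real.exp 1 ≤ X' := le_trans (le_max_left _ _) hX'
  have hXC : C ^ (1 / ε) ≤ X' := le_trans (le_max_right _ _) hX'
  have hX0 : 0 < X' := (Real.exp_pos 1).trans_le hXe
  have hX1 : 1 ≤ X' := le_trans (by have := Real.exp_one_gt_d9; linarith) hXe
  have hL1 : 1 ≤ Real.log X' := by rwa [Real.le_log_iff_exp_le hX0]
  have hlog : Real.log X' ^ B₁ ≤ X' ^ (2 * ε) := by
    calc Real.log X' ^ B₁ ≤ Real.log X' ^ max B₁ 0 := Real.rpow_le_rpow_of_exponent_le hL1 (le_max_left _ _)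
      _ ≤ C * X' ^ ε := h X' hX1
      _ ≤ X' ^ ε * X' ^ ε := by
          refine mul_le_mul_of_nonneg_right ?_ (Real.rpow_nonneg hX0.le _)
          calc C = (C ^ (1 / ε)) ^ ε := by rw [← Real.rpow_mul hC.le]; field_simp; simp
            _ ≤ X' ^ ε := Real.rpow_le_rpow (Real.rpow_nonneg hC.le _) hXC hε.le
      _ = X' ^ (2 * ε) := by rw [← Real.rpow_add hX0]; ring_nf
  have hLB : 0 < Real.log X' ^ B₁ := Real.rpow_pos_of_pos (by linarith) _
  rw [le_div_iff₀ hLB]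
  calc X' ^ (1 / 2 - 2 * ε) * Real.log X' ^ B₁ ≤ X' ^ (1 / 2 - 2 * ε) * X' ^ (2 * ε) :=
        mul_le_mul_of_nonneg_left hlog (Real.rpow_nonneg hX0.le _)
    _ = X' ^ (1 / 2 : ℝ) := by rw [← Real.rpow_add hX0]; ring_nf

/-- Polylogarithms lose against any power: for `e > 0`, `C, k ≥ 0` there is `x₀` with
`C (4 log x)^k ≤ x^e` for `x ≥ x₀`. [folklore] -/
theorem exists_polylog_le_rpow {C k e : ℝ} (hC : 0 ≤ C) (hk : 0 ≤ k) (he : 0 < e) :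
    ∃ x₀ : ℝ, ∀ x : ℝ, x₀ ≤ x → C * (4 * Real.log x) ^ k ≤ x ^ e := by
  obtain ⟨C', hC', h⟩ := exists_log_rpow_le_rpow hk (half_pos he)
  refine ⟨max (Real.exp 1) ((C * 4 ^ k * C' + 1) ^ (2 / e)), fun x hx => ?_⟩
  have hxe : Real.exp 1 ≤ x := le_trans (le_max_left _ _) hx
  have hxC : (C * 4 ^ k * C' + 1) ^ (2 / e) ≤ x := le_trans (le_max_right _ _) hx
  have hx0 : 0 < x := (Real.exp_pos 1).trans_le hxe
  have hx1 : 1 ≤ x := le_trans (by have := Real.exp_one_gt_d9; linarith) hxe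
  have hL0 : 0 ≤ Real.log x := Real.log_nonneg hx1
  have h1 : (C * 4 ^ k * C' + 1) ≤ x ^ (e / 2) := by
    calc (C * 4 ^ k * C' + 1) = ((C * 4 ^ k * C' + 1) ^ (2 / e)) ^ (e / 2) := by
          rw [← Real.rpow_mul (by positivity)]; field_simp; simp
      _ ≤ x ^ (e / 2) := Real.rpow_le_rpow (Real.rpow_nonneg (by positivity) _) hxC (by positivity)
  calc C * (4 * Real.log x) ^ k = C * 4 ^ k * Real.log x ^ k := by
        rw [Real.mul_rpow (by norm_num) hL0]; ring
    _ ≤ C * 4 ^ k * (C' * x ^ (e / 2)) := mul_le_mul_of_nonneg_left (h x hx1) (by positivity)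
    _ = (C * 4 ^ k * C') * x ^ (e / 2) := by ring
    _ ≤ (C * 4 ^ k * C' + 1) * x ^ (e / 2) :=
        mul_le_mul_of_nonneg_right (by linarith) (Real.rpow_nonneg hx0.le _)
    _ ≤ x ^ (e / 2) * x ^ (e / 2) := mul_le_mul_of_nonneg_right h1 (Real.rpow_nonneg hx0.le _)
    _ = x ^ e := by rw [← Real.rpow_add hx0]; ring_nf

/-! ### The block decomposition and the `ℓ²` bookkeeping -/

/-- **The well-factorable split at level `D = D₁ D₂` with dyadic blocks** (packaging of
`wellFactorable_sum_bilinDisc_eq` with the choice of the dyadic depth `K₁`, `D₁ < 2^{K₁} ≤ 2D₁`):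
for `λ` well factorable of level `D` and `1 ≤ D₂ ≤ D` there are `λ₁, λ₂` (bounded by `1`,
supported on `[1, D₁]`, `[1, D₂]`, `D₁ = D/D₂`) and `K₁` with `2^{K₁} ≤ 2D₁` such that for all
`a, M, N, α, β, K₂`,
`∑_{d ≤ D, (d,a)=1} λ(d) Δ_{α⋆β}(d) = (remainder over r ≤ D₂/2^{K₂}) + ∑_{k<K₁} ∑_{k'<K₂} 𝒟(M,N,D₁/2^{k+1},D₂/2^{k'+1})`,
every block having `1/2 ≤ D₁/2^{k+1} ≤ D₁/2`. [cite: BombieriFriedlanderIwaniecActa1986, §17 p. 249] -/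
theorem wellFactorable_blocks {D D₂ : ℝ} {lam : ℕ → ℝ} (h : IsWellFactorable D lam)
    (hD₂ : 1 ≤ D₂) (hD₂D : D₂ ≤ D) :
    ∃ lam₁ lam₂ : ArithmeticFunction ℝ, ∃ K₁ : ℕ,
      (∀ n, |lam₁ n| ≤ 1) ∧ (∀ n, |lam₂ n| ≤ 1) ∧
      (∀ n : ℕ, D / D₂ < n → lam₁ n = 0) ∧ (∀ n : ℕ, D₂ < n → lam₂ n = 0) ∧
      (2 : ℝ) ^ K₁ ≤ 2 * (D / D₂) ∧
      (∀ k, k < K₁ → 1 / 2 ≤ D / D₂ / 2 ^ (k + 1) ∧ D / D₂ / 2 ^ (k + 1) ≤ D / D₂ / 2) ∧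
      ∀ (a : ℤ) (M N : ℝ) (α β : ℕ → ℝ) (K₂ : ℕ),
        ∑ d ∈ (Icc 1 ⌊D⌋₊).filter (fun d : ℕ => IsCoprime (d : ℤ) a), lam d * bilinDisc a M N α β d =
          (∑ q ∈ Icc 1 ⌊D / D₂⌋₊, ∑ r ∈ Icc 1 ⌊D₂ / 2 ^ K₂⌋₊,
              lam₁ q * lam₂ r * (if IsCoprime ((q * r : ℕ) : ℤ) a then bilinDisc a M N α β (q * r) else 0)) +
            ∑ k ∈ Finset.range K₁, ∑ k' ∈ Finset.range K₂,
              dispD a M N (D / D₂ / 2 ^ (k + 1)) (D₂ / 2 ^ (k' + 1)) α β lam₁ lam₂ := by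
  have hD₂0 : 0 < D₂ := by linarith
  have hD₁ : 1 ≤ D / D₂ := by rwa [le_div_iff₀ hD₂0, one_mul]
  obtain ⟨lam₁, lam₂, h1, h2, hs1, hs2, hdec⟩ :=
    wellFactorable_sum_bilinDisc_eq h hD₁ hD₂ (by field_simp)
  obtain ⟨K₁, hK₁, hK₁'⟩ := exists_pow_two_near hD₁
  refine ⟨lam₁, lam₂, K₁, h1, h2, hs1, hs2, hK₁', fun k hk => ⟨?_, ?_⟩,
    fun a M N α β K₂ => hdec a M N α β K₁ K₂ hK₁⟩
  · rw [le_div_iff₀ (by positivity)]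
    have hpow : (2 : ℝ) ^ (k + 1) ≤ 2 ^ K₁ := pow_le_pow_right₀ (by norm_num) hk
    linarith
  · exact div_le_div_of_nonneg_left (by linarith) (by norm_num)
      (le_self_pow₀ (by norm_num) (by omega))

/-- Summing a uniform block bound: `|∑_{k<K₁} ∑_{k'<K₂} f k k'| ≤ K₁ K₂ B` if `|f k k'| ≤ B` blockwise. [folklore] -/
theorem abs_sum_sum_range_le {K₁ K₂ : ℕ} {f : ℕ → ℕ → ℝ} {B : ℝ}
    (h : ∀ k, k < K₁ → ∀ k', k' < K₂ → |f k k'| ≤ B) :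
    |∑ k ∈ Finset.range K₁, ∑ k' ∈ Finset.range K₂, f k k'| ≤ K₁ * K₂ * B := by
  calc |∑ k ∈ Finset.range K₁, ∑ k' ∈ Finset.range K₂, f k k'|
      ≤ ∑ k ∈ Finset.range K₁, ∑ k' ∈ Finset.range K₂, |f k k'| :=
        (Finset.abs_sum_le_sum_abs _ _).trans (Finset.sum_le_sum fun k _ => Finset.abs_sum_le_sum_abs _ _)
    _ ≤ ∑ k ∈ Finset.range K₁, ∑ k' ∈ Finset.range K₂, B :=
        Finset.sum_le_sum fun k hk => Finset.sum_le_sum fun k' hk' =>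
          h k (Finset.mem_range.1 hk) k' (Finset.mem_range.1 hk')
    _ = K₁ * K₂ * B := by simp [Finset.sum_const, Finset.card_range]; ring

/-- The `ℓ²`/`sqrt` algebra of the Theorem 5* bound: for `‖β‖² ≤ C_l N (log 2N)^{2E'}`, `MN = X'`,
`1 ≤ N ≤ X'`, `2 ≤ X'`: `‖β‖ X'^{1/2} M^{1/2} ≤ √C_l (2 log X')^{E'} X'`. [folklore] -/
theorem sqrt_l2Sq_mul_le {Cl N M X' : ℝ} {E' : ℕ} (hN : 1 ≤ N) (hM : 0 ≤ M) (hX' : 2 ≤ X')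
    (hMN : M * N = X') (hCl : 0 < Cl) {β : ℕ → ℝ}
    (hl2 : l2Sq N β ≤ Cl * N * Real.log (2 * N) ^ (2 * E')) (hNX : N ≤ X') :
    Real.sqrt (l2Sq N β) * X' ^ (1 / 2 : ℝ) * M ^ (1 / 2 : ℝ) ≤
      Real.sqrt Cl * (2 * Real.log X') ^ E' * X' := by
  have hlog2N : Real.log (2 * N) ≤ 2 * Real.log X' := by
    have h1 : 2 * N ≤ X' ^ 2 := by nlinarith
    calc Real.log (2 * N) ≤ Real.log (X' ^ 2) := Real.log_le_log (by linarith) h1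
      _ = 2 * Real.log X' := by rw [Real.log_pow]; norm_num
  have hlog0 : 0 ≤ Real.log (2 * N) := Real.log_nonneg (by linarith)
  have h1 : Real.sqrt (l2Sq N β) ≤ Real.sqrt Cl * Real.sqrt N * (2 * Real.log X') ^ E' := by
    calc Real.sqrt (l2Sq N β) ≤ Real.sqrt (Cl * N * Real.log (2 * N) ^ (2 * E')) := Real.sqrt_le_sqrt hl2
      _ = Real.sqrt Cl * Real.sqrt N * Real.log (2 * N) ^ E' := by
          rw [Real.sqrt_mul (by positivity), Real.sqrt_mul hCl.le, pow_mul', Real.sqrt_sq (by positivity)]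
      _ ≤ Real.sqrt Cl * Real.sqrt N * (2 * Real.log X') ^ E' :=
          mul_le_mul_of_nonneg_left (pow_le_pow_left₀ hlog0 hlog2N E') (by positivity)
  have h2 : Real.sqrt N * (X' ^ (1 / 2 : ℝ) * M ^ (1 / 2 : ℝ)) = X' := by
    rw [← Real.sqrt_eq_rpow, ← Real.sqrt_eq_rpow, ← Real.sqrt_mul (by linarith),
      ← Real.sqrt_mul (by positivity)]
    rw [show N * (X' * M) = X' * X' by rw [← hMN]; ring]
    exact Real.sqrt_mul_self (by linarith)
  calc Real.sqrt (l2Sq N β) * X' ^ (1 / 2 : ℝ) * M ^ (1 / 2 : ℝ)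
      ≤ (Real.sqrt Cl * Real.sqrt N * (2 * Real.log X') ^ E') * X' ^ (1 / 2 : ℝ) * M ^ (1 / 2 : ℝ) := by
        gcongr
    _ = Real.sqrt Cl * (2 * Real.log X') ^ E' * (Real.sqrt N * (X' ^ (1 / 2 : ℝ) * M ^ (1 / 2 : ℝ))) := by ring
    _ = Real.sqrt Cl * (2 * Real.log X') ^ E' * X' := by rw [h2]

/-- `√‖α‖² ≤ √C_l √M (2 log X')^{E'}` for `‖α‖² ≤ C_l M (log 2M)^{2E'}`, `1 ≤ M ≤ X'`, `2 ≤ X'`.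
[folklore] -/
theorem sqrt_l2Sq_le {Cl M X' : ℝ} {E' : ℕ} (hM : 1 ≤ M) (hMX : M ≤ X') (hX' : 2 ≤ X') (hCl : 0 < Cl)
    {α : ℕ → ℝ} (hl2 : l2Sq M α ≤ Cl * M * Real.log (2 * M) ^ (2 * E')) :
    Real.sqrt (l2Sq M α) ≤ Real.sqrt Cl * Real.sqrt M * (2 * Real.log X') ^ E' := by
  have hlog2M : Real.log (2 * M) ≤ 2 * Real.log X' := by
    have h1 : 2 * M ≤ X' ^ 2 := by nlinarith
    calc Real.log (2 * M) ≤ Real.log (X' ^ 2) := Real.log_le_log (by linarith) h1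
      _ = 2 * Real.log X' := by rw [Real.log_pow]; norm_num
  have hlog0 : 0 ≤ Real.log (2 * M) := Real.log_nonneg (by linarith)
  calc Real.sqrt (l2Sq M α) ≤ Real.sqrt (Cl * M * Real.log (2 * M) ^ (2 * E')) := Real.sqrt_le_sqrt hl2
    _ = Real.sqrt Cl * Real.sqrt M * Real.log (2 * M) ^ E' := by
        rw [Real.sqrt_mul (by positivity), Real.sqrt_mul hCl.le, pow_mul', Real.sqrt_sq (by positivity)]
    _ ≤ Real.sqrt Cl * Real.sqrt M * (2 * Real.log X') ^ E' :=
        mul_le_mul_of_nonneg_left (pow_le_pow_left₀ hlog0 hlog2M E') (by positivity)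

/-- The `ℓ²` bookkeeping of a Theorem 1/2 block: if
`𝒟² ≤ (∑_{r∼R} δ_r²)(∑_{m∼M} α_m²) · (C₁ ‖β‖² X' R⁻¹ / (log X')^{A'})` with `|δ| ≤ 1`, `R ≥ 1/2`,
`‖α‖² ≤ C_l M (log 2M)^{2E'}`, `‖β‖² ≤ C_l N (log 2N)^{2E'}`, `MN = X'`, `1 ≤ M, N ≤ X'`, `2 ≤ X'`, then
`|𝒟| ≤ 2 √C₁ C_l X' (2 log X')^{2E'} / (log X')^{A'/2}`. [folklore] -/
theorem abs_dispD_le_of_sq_bound {Dv C₁ Cl M N X' R A' : ℝ} {E' : ℕ} {α β δ : ℕ → ℝ}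
    (hC₁ : 0 ≤ C₁) (hCl : 0 < Cl) (hX' : 2 ≤ X') (hMN : M * N = X') (hM1 : 1 ≤ M) (hMX : M ≤ X')
    (hN1 : 1 ≤ N) (hNX : N ≤ X') (hR : 1 / 2 ≤ R) (hδ : ∀ r, |δ r| ≤ 1)
    (hα : l2Sq M α ≤ Cl * M * Real.log (2 * M) ^ (2 * E'))
    (hβ : l2Sq N β ≤ Cl * N * Real.log (2 * N) ^ (2 * E'))
    (hsq : Dv ^ 2 ≤ (∑ r ∈ dyadic R, δ r ^ 2) * (∑ m ∈ dyadic M, α m ^ 2) *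
      (C₁ * l2Sq N β * X' * R⁻¹ / Real.log X' ^ A')) :
    |Dv| ≤ 2 * Real.sqrt C₁ * Cl * X' * (2 * Real.log X') ^ (2 * E') / Real.log X' ^ (A' / 2) := by
  have hX'0 : 0 < X' := by linarith
  have hLX : 0 < Real.log X' := Real.log_pos (by linarith)
  have hlog : ∀ T : ℝ, 1 ≤ T → T ≤ X' → Real.log (2 * T) ^ (2 * E') ≤ (2 * Real.log X') ^ (2 * E') := by
    intro T hT1 hTX
    have h1 : 2 * T ≤ X' ^ 2 := by nlinarith
    refine pow_le_pow_left₀ (Real.log_nonneg (by linarith)) ?_ _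
    calc Real.log (2 * T) ≤ Real.log (X' ^ 2) := Real.log_le_log (by linarith) h1
      _ = 2 * Real.log X' := by rw [Real.log_pow]; norm_num
  have hδ2 : ∑ r ∈ dyadic R, δ r ^ 2 ≤ 4 * R := by
    calc ∑ r ∈ dyadic R, δ r ^ 2 ≤ ∑ r ∈ dyadic R, (1 : ℝ) := by
          refine Finset.sum_le_sum fun r _ => ?_
          have h := hδ r
          rw [abs_le] at h
          nlinarith
      _ = #(dyadic R) := by simp
      _ ≤ 2 * R + 1 := card_dyadic_le (by linarith)
      _ ≤ 4 * R := by linarith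
  have hα' : ∑ m ∈ dyadic M, α m ^ 2 ≤ Cl * M * (2 * Real.log X') ^ (2 * E') :=
    hα.trans (mul_le_mul_of_nonneg_left (hlog M hM1 hMX) (by positivity))
  have hβ' : l2Sq N β ≤ Cl * N * (2 * Real.log X') ^ (2 * E') :=
    hβ.trans (mul_le_mul_of_nonneg_left (hlog N hN1 hNX) (by positivity))
  set B : ℝ := 2 * Real.sqrt C₁ * Cl * X' * (2 * Real.log X') ^ (2 * E') / Real.log X' ^ (A' / 2) with hB
  have hB0 : 0 ≤ B := by rw [hB]; positivity
  refine abs_le_of_sq_le_sq (hsq.trans ?_) hB0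
  have hR0 : 0 < R := by linarith
  have hden : 0 < Real.log X' ^ A' := Real.rpow_pos_of_pos hLX _
  have hl2N : 0 ≤ l2Sq N β := l2Sq_nonneg _ _
  set s : ℝ := Real.sqrt C₁ with hs_def
  have hs2 : s ^ 2 = C₁ := Real.sq_sqrt hC₁
  calc (∑ r ∈ dyadic R, δ r ^ 2) * (∑ m ∈ dyadic M, α m ^ 2) * (C₁ * l2Sq N β * X' * R⁻¹ / Real.log X' ^ A')
      ≤ (4 * R) * (Cl * M * (2 * Real.log X') ^ (2 * E')) *
          (C₁ * (Cl * N * (2 * Real.log X') ^ (2 * E')) * X' * R⁻¹ / Real.log X' ^ A') := by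
        refine mul_le_mul (mul_le_mul hδ2 hα' (Finset.sum_nonneg fun _ _ => sq_nonneg _) (by positivity))
          ?_ ?_ (by positivity)
        · refine div_le_div_of_nonneg_right ?_ hden.le
          refine mul_le_mul_of_nonneg_right (mul_le_mul_of_nonneg_right
            (mul_le_mul_of_nonneg_left hβ' hC₁) hX'0.le) (by positivity)
        · exact div_nonneg (mul_nonneg (mul_nonneg (mul_nonneg hC₁ hl2N) hX'0.le)
            (inv_nonneg.2 hR0.le)) hden.le
    _ = 4 * C₁ * Cl ^ 2 * (M * N) * X' * (2 * Real.log X') ^ (4 * E') / Real.log X' ^ A' := by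
        have h4 : (2 * Real.log X') ^ (4 * E') = (2 * Real.log X') ^ (2 * E') * (2 * Real.log X') ^ (2 * E') := by
          rw [← pow_add]; ring_nf
        rw [h4]
        field_simp
    _ = B ^ 2 := by
        rw [hB, hMN, div_pow, ← Real.rpow_natCast (Real.log X' ^ (A' / 2)) 2, ← Real.rpow_mul hLX.le]
        have h2 : A' / 2 * ((2 : ℕ) : ℝ) = A' := by push_cast; ring
        have h4 : (2 * Real.log X') ^ (4 * E') = ((2 * Real.log X') ^ (2 * E')) ^ 2 := by
          rw [← pow_mul]; ring_nf
        rw [h2, h4, ← hs2]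
        ring

/-- `|λ q| ≤ 1` and `λ 0 = 0` give the divisor-type bound `|λ q| ≤ τ(q)^2` of hypothesis (A₃)
(real exponent). [folklore] -/
theorem abs_le_sigma_rpow_two {lam : ArithmeticFunction ℝ} (h : ∀ n, |lam n| ≤ 1) (q : ℕ) :
    |lam q| ≤ (σ 0 q : ℝ) ^ (2 : ℝ) := by
  rcases Nat.eq_zero_or_pos q with rfl | hq
  · simp
  · have h1 : (1 : ℝ) ≤ (σ 0 q : ℝ) := by exact_mod_cast one_le_sigma_zero hq.ne'
    exact (h q).trans (Real.one_le_rpow h1 (by norm_num))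

/-- `∑_{r ∼ R} δ_r² ≤ 4R` for `|δ| ≤ 1` and `R ≥ 1/2`. [folklore] -/
theorem sum_dyadic_sq_le {δ : ℕ → ℝ} (h : ∀ n, |δ n| ≤ 1) {R : ℝ} (hR : 1 / 2 ≤ R) :
    ∑ r ∈ dyadic R, δ r ^ 2 ≤ 4 * R := by
  calc ∑ r ∈ dyadic R, δ r ^ 2 ≤ ∑ r ∈ dyadic R, (1 : ℝ) := by
        refine Finset.sum_le_sum fun r _ => ?_
        have h1 := h r
        rw [abs_le] at h1
        nlinarith
    _ = #(dyadic R) := by simp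
    _ ≤ 2 * R + 1 := card_dyadic_le (by linarith)
    _ ≤ 4 * R := by linarith

/-- Cauchy–Schwarz for `∑_{n∼N} |β_n| τ(n)^r`: `≤ ‖β‖ (∑_{n∼N} τ(n)^{2r})^{1/2}`. [folklore] -/
theorem sum_abs_mul_sigma_pow_le (N : ℝ) (β : ℕ → ℝ) (r : ℕ) :
    ∑ n ∈ dyadic N, |β n| * (σ 0 n : ℝ) ^ r ≤
      Real.sqrt (l2Sq N β) * Real.sqrt (∑ n ∈ dyadic N, (σ 0 n : ℝ) ^ (2 * r)) := by
  rw [← Real.sqrt_mul (l2Sq_nonneg _ _)]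
  refine (Real.le_sqrt (Finset.sum_nonneg fun _ _ => by positivity)
    (mul_nonneg (l2Sq_nonneg _ _) (Finset.sum_nonneg fun _ _ => by positivity))).2 ?_
  refine (Finset.sum_mul_sq_le_sq_mul_sq _ _ _).trans (le_of_eq ?_)
  unfold l2Sq
  congr 1
  · exact Finset.sum_congr rfl fun n _ => sq_abs _
  · exact Finset.sum_congr rfl fun n _ => by rw [← pow_mul, mul_comm]

/-- The algebra of the Theorem 0 (b) bound: with `√‖α‖² ≤ √C_l √M (2L)^{E'}`,
`√‖β‖² ≤ √C_l √N (2L)^{E'}` and `MN = X'`,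
`C₀ √‖α‖² √‖β‖² X'^{1/2} ≤ C₀⁺ C_l 2^{2E'} X' L^{2E'}`. [folklore] -/
theorem thm0b_bound_algebra {C₀ Cl M N X' L sα sβ : ℝ} {E' : ℕ} (hCl : 0 < Cl) (hM0 : 0 ≤ M)
    (hX'0 : 0 ≤ X') (hMN : M * N = X') (hL : 0 ≤ L) (hsα0 : 0 ≤ sα) (hsβ0 : 0 ≤ sβ)
    (hsα : sα ≤ Real.sqrt Cl * Real.sqrt M * (2 * L) ^ E')
    (hsβ : sβ ≤ Real.sqrt Cl * Real.sqrt N * (2 * L) ^ E') :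
    C₀ * sα * sβ * X' ^ (1 / 2 : ℝ) ≤ max C₀ 0 * Cl * 2 ^ (2 * E') * X' * L ^ (2 * E') := by
  have k0 : 0 ≤ sα * sβ * X' ^ (1 / 2 : ℝ) := by positivity
  have j1 : C₀ * sα * sβ * X' ^ (1 / 2 : ℝ) ≤
      max C₀ 0 * ((Real.sqrt Cl * Real.sqrt M * (2 * L) ^ E') * (Real.sqrt Cl * Real.sqrt N * (2 * L) ^ E') *
        X' ^ (1 / 2 : ℝ)) := by
    calc C₀ * sα * sβ * X' ^ (1 / 2 : ℝ) = C₀ * (sα * sβ * X' ^ (1 / 2 : ℝ)) := by ring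
      _ ≤ max C₀ 0 * (sα * sβ * X' ^ (1 / 2 : ℝ)) := mul_le_mul_of_nonneg_right (le_max_left _ _) k0
      _ ≤ _ := by
          refine mul_le_mul_of_nonneg_left ?_ (le_max_right _ _)
          exact mul_le_mul_of_nonneg_right (mul_le_mul hsα hsβ hsβ0 (by positivity)) (Real.rpow_nonneg hX'0 _)
  have j2 : Real.sqrt M * Real.sqrt N * X' ^ (1 / 2 : ℝ) = X' := by
    rw [← Real.sqrt_mul hM0, hMN, ← Real.sqrt_eq_rpow, Real.mul_self_sqrt hX'0]
  have j3 : Real.sqrt Cl * Real.sqrt Cl = Cl := Real.mul_self_sqrt hCl.le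
  have j4 : (2 * L) ^ E' * (2 * L) ^ E' = 2 ^ (2 * E') * L ^ (2 * E') := by
    rw [← pow_add, mul_pow, show E' + E' = 2 * E' by ring]
  calc C₀ * sα * sβ * X' ^ (1 / 2 : ℝ) ≤ _ := j1
    _ = max C₀ 0 * (Real.sqrt Cl * Real.sqrt Cl) * (Real.sqrt M * Real.sqrt N * X' ^ (1 / 2 : ℝ)) *
          ((2 * L) ^ E' * (2 * L) ^ E') := by ring
    _ = max C₀ 0 * Cl * 2 ^ (2 * E') * X' * L ^ (2 * E') := by rw [j2, j3, j4]; ring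

/-! ### Hypothesis (A₅) for dense pieces -/

/-- **Hypothesis (A₅) for dense pieces** (BFI (A₅), p. 229: `N^{1−ε} ∑|β_n|⁴ ≪ (∑|β_n|²)²`): for
`|β| ≤ τ^{13}` on `n ∼ N`, `N = X'^s ≥ X'^{1/5}`, `x ≤ X' ≤ 2^{15} x` and `β` DENSE
(`N ≤ (log 2N)^{c_D} ‖β‖²`), one has `N^{1−ε₅} ∑_{n∼N} β_n⁴ ≤ ‖β‖⁴` as soon as `x ≥ x₀(ε₅, c_D)`
(the divisor moment `∑ τ^{52} ≪ N (log 2N)^{2^{53}}` loses only logarithms).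
[cite: BombieriFriedlanderIwaniecActa1986, §9 (A₅) p. 229] -/
theorem a5_of_dense {cD ε₅ : ℝ} (hcD : 0 ≤ cD) (hε₅ : 0 < ε₅) :
    ∃ x₀ : ℝ, ∀ x : ℝ, x₀ ≤ x → ∀ (X' N s : ℝ) (β : ℕ → ℝ),
      x ≤ X' → X' ≤ 2 ^ 15 * x → N = X' ^ s → 1 / 5 ≤ s → s ≤ 1 →
      (∀ n, |β n| ≤ (σ 0 n : ℝ) ^ 13) →
      N ≤ Real.log (2 * N) ^ cD * l2Sq N β →
      N ^ (1 - ε₅) * (∑ n ∈ dyadic N, β n ^ 4) ≤ 1 * l2Sq N β ^ 2 := by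
  obtain ⟨C4, hC4, h4⟩ := exists_sum_dyadic_sigma_zero_pow_le 52
  obtain ⟨E, hE⟩ : ∃ E : ℕ, E = 2 ^ (52 + 1) := ⟨_, rfl⟩
  rw [← hE] at h4
  obtain ⟨x₁, hx₁⟩ := exists_polylog_le_rpow hC4.le (show (0 : ℝ) ≤ E + 2 * cD by positivity)
    (show 0 < ε₅ / 5 by positivity)
  refine ⟨max x₁ (2 ^ 15), fun x hx X' N s β hxX hX'x hNs hs1 hs2 hβ hdense => ?_⟩
  have hx1' : x₁ ≤ x := le_trans (le_max_left _ _) hx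
  have hx15 : (2 : ℝ) ^ 15 ≤ x := le_trans (le_max_right _ _) hx
  have hx0 : 0 < x := by linarith
  have hx1 : (1 : ℝ) ≤ x := by linarith
  have hX'1 : (1 : ℝ) ≤ X' := hx1.trans hxX
  have hX'0 : 0 < X' := by linarith
  have hN1 : 1 ≤ N := by rw [hNs]; exact Real.one_le_rpow hX'1 (by linarith)
  have hN0 : 0 < N := by linarith
  have hNX : N ≤ X' := by
    rw [hNs]
    calc X' ^ s ≤ X' ^ (1 : ℝ) := Real.rpow_le_rpow_of_exponent_le hX'1 hs2
      _ = X' := Real.rpow_one X'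
  set ℓ : ℝ := Real.log (2 * N) with hℓ
  have hℓ0 : 0 ≤ ℓ := Real.log_nonneg (by linarith)
  have hℓ4 : ℓ ≤ 4 * Real.log x := by
    have hX2 : X' ≤ x * x := by nlinarith
    have h1 : 2 * N ≤ x ^ 4 := by
      calc 2 * N ≤ 2 * (x * x) := by linarith
        _ ≤ (x * x) * (x * x) := by nlinarith
        _ = x ^ 4 := by ring
    calc ℓ ≤ Real.log (x ^ 4) := Real.log_le_log (by linarith) h1
      _ = 4 * Real.log x := by rw [Real.log_pow]; norm_num
  -- `∑ β⁴ ≤ C4 N ℓ^E`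
  have hβ4 : ∑ n ∈ dyadic N, β n ^ 4 ≤ C4 * N * ℓ ^ E := by
    refine le_trans (Finset.sum_le_sum fun n _ => ?_) (h4 N hN1)
    have h1 := hβ n
    have h2 : β n ^ 4 = |β n| ^ 4 := by rw [pow_abs, abs_of_nonneg (by positivity)]
    rw [h2, show (52 : ℕ) = 13 * 4 by norm_num, pow_mul]
    exact pow_le_pow_left₀ (abs_nonneg _) h1 4
  -- `C4 ℓ^{E + 2 c_D} ≤ N^{ε₅}`
  have hNε : x ^ (ε₅ / 5) ≤ N ^ ε₅ := by
    have h1 : x ^ (1 / 5 : ℝ) ≤ N := by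
      rw [hNs]
      calc x ^ (1 / 5 : ℝ) ≤ X' ^ (1 / 5 : ℝ) := Real.rpow_le_rpow hx0.le hxX (by norm_num)
        _ ≤ X' ^ s := Real.rpow_le_rpow_of_exponent_le hX'1 hs1
    calc x ^ (ε₅ / 5) = (x ^ (1 / 5 : ℝ)) ^ ε₅ := by rw [← Real.rpow_mul hx0.le]; ring_nf
      _ ≤ N ^ ε₅ := Real.rpow_le_rpow (Real.rpow_nonneg hx0.le _) h1 hε₅.le
  have hkey : C4 * ℓ ^ ((E : ℝ) + 2 * cD) ≤ N ^ ε₅ := by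
    calc C4 * ℓ ^ ((E : ℝ) + 2 * cD) ≤ C4 * (4 * Real.log x) ^ ((E : ℝ) + 2 * cD) :=
          mul_le_mul_of_nonneg_left (Real.rpow_le_rpow hℓ0 hℓ4 (by positivity)) hC4.le
      _ ≤ x ^ (ε₅ / 5) := hx₁ x hx1'
      _ ≤ N ^ ε₅ := hNε
  -- `‖β‖² ≥ N ℓ^{-c_D}`
  have hl2 : N * ℓ ^ (-cD) ≤ l2Sq N β := by
    rcases eq_or_lt_of_le hℓ0 with h0 | hℓpos
    · -- `ℓ = 0` is impossible for `N ≥ 1`, but the bound is trivial to state: use `hdense`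
      rw [← h0] at hdense
      rcases eq_or_lt_of_le hcD with hc0 | hcpos
      · rw [← hc0, Real.rpow_zero, one_mul] at hdense
        rw [← h0, ← hc0, neg_zero, Real.rpow_zero, mul_one]; exact hdense
      · rw [Real.zero_rpow hcpos.ne', zero_mul] at hdense; linarith
    · rw [Real.rpow_neg hℓpos.le, ← div_eq_mul_inv, div_le_iff₀ (Real.rpow_pos_of_pos hℓpos _)]
      linarith [mul_comm (Real.log (2 * N) ^ cD) (l2Sq N β)]
  -- conclude
  rcases eq_or_lt_of_le hℓ0 with h0 | hℓpos
  · -- degenerate `ℓ = 0`: then `ℓ^E = 0^E`; handle via `hβ4` with `E ≥ 1`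
    have hE1 : E ≠ 0 := by rw [hE]; positivity
    rw [← h0, zero_pow hE1, mul_zero] at hβ4
    have : ∑ n ∈ dyadic N, β n ^ 4 = 0 := le_antisymm hβ4 (Finset.sum_nonneg fun _ _ => by positivity)
    rw [this, mul_zero, one_mul]; positivity
  · have h1 : N ^ (1 - ε₅) * (∑ n ∈ dyadic N, β n ^ 4) ≤ N ^ (1 - ε₅) * (C4 * N * ℓ ^ E) :=
      mul_le_mul_of_nonneg_left hβ4 (Real.rpow_nonneg hN0.le _)
    have hcancel : ℓ ^ (2 * cD) * ℓ ^ (-(2 * cD)) = 1 := by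
      rw [Real.rpow_neg hℓpos.le, mul_inv_cancel₀ (Real.rpow_pos_of_pos hℓpos _).ne']
    have hu : C4 * ℓ ^ E = ℓ ^ (-(2 * cD)) * (C4 * ℓ ^ ((E : ℝ) + 2 * cD)) := by
      rw [Real.rpow_add hℓpos, Real.rpow_natCast]
      calc C4 * ℓ ^ E = C4 * ℓ ^ E * (ℓ ^ (2 * cD) * ℓ ^ (-(2 * cD))) := by rw [hcancel, mul_one]
        _ = _ := by ring
    have h5 : (N * ℓ ^ (-cD)) ^ 2 ≤ l2Sq N β ^ 2 :=
      pow_le_pow_left₀ (mul_nonneg hN0.le (Real.rpow_nonneg hℓpos.le _)) hl2 2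
    calc N ^ (1 - ε₅) * (∑ n ∈ dyadic N, β n ^ 4) ≤ N ^ (1 - ε₅) * (C4 * N * ℓ ^ E) := h1
      _ = N ^ (1 - ε₅) * N * (C4 * ℓ ^ E) := by ring
      _ = N ^ (1 - ε₅) * N * (ℓ ^ (-(2 * cD)) * (C4 * ℓ ^ ((E : ℝ) + 2 * cD))) := by rw [hu]
      _ ≤ N ^ (1 - ε₅) * N * (ℓ ^ (-(2 * cD)) * N ^ ε₅) :=
          mul_le_mul_of_nonneg_left (mul_le_mul_of_nonneg_left hkey (Real.rpow_nonneg hℓpos.le _))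
            (mul_nonneg (Real.rpow_nonneg hN0.le _) hN0.le)
      _ = (N ^ (1 - ε₅) * N ^ ε₅) * N * ℓ ^ (-(2 * cD)) := by ring
      _ = N * N * ℓ ^ (-(2 * cD)) := by rw [← Real.rpow_add hN0, sub_add_cancel, Real.rpow_one]
      _ = (N * ℓ ^ (-cD)) ^ 2 := by
          rw [show -(2 * cD) = -cD + -cD by ring, Real.rpow_add hℓpos]; ring
      _ ≤ l2Sq N β ^ 2 := h5
      _ = 1 * l2Sq N β ^ 2 := (one_mul _).symm

end BFI

end Literature.NumberTheory.Sieve
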